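import Literature.Analysis.SpecialFunctions.LaguerreOrthogonality
import Literature.NumberTheory.LFunctions.LogIntegralLaplaceTransform
import Mathlib.Analysis.Distribution.AEEqOfIntegralContDiff
import Mathlib.Topology.ContinuousMap.Weierstrass
import HarnessLib

/-!
# Uniqueness of Laguerre expansions for exponentially tempered functions

RH-FREE real analysis (support for [AriasDeReyna2011KeiperLi] Cor 5.1 ⟹).  The classical completeness /
uniqueness theorem behind the Laguerre system (Szegő, *Orthogonal Polynomials*, Thm 5.7.1): a function `w`
on `(0, ∞)` with `∫₀^∞ |w(t)| e^{δt} dt < ∞` for some `δ > 0` whose moments `∫₀^∞ w(t) tᵏ dt` all vanish —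
equivalently, whose integrals against all Laguerre polynomials `L_n` vanish — is `0` almost everywhere.

The printed road (Laplace transform): `Φ(s) = ∫₀^∞ w(t) e^{−st} dt` is holomorphic on `Re s > −δ` (in the
tree's currency, `Φ = Landau.mellinIoi (w ∘ log)`, holomorphic by `Landau.differentiableOn_mellinIoi`), its
derivatives at `0` are the moments (`Landau.iteratedDeriv_mellinIoi`), so `Φ ≡ 0`; in particular
`Φ(n) = ∫₀¹ w(−log y) yⁿ⁻¹ dy = 0` for `n ≥ 1`, and a function on `(0,1)` with vanishing power moments is `0`
a.e. (Weierstrass approximation + the smooth-test-function criterion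
`IsOpen.ae_eq_zero_of_integral_contDiff_smul_eq_zero`).

* `ae_eq_zero_of_forall_integral_pow_eq_zero` — moments on `(0,1)` determine an integrable function;
* `ae_eq_zero_of_forall_integral_mul_pow_eq_zero` — the theorem on `(0,∞)` with weight `e^{δt}`;
* `ae_eq_zero_of_forall_integral_mul_laguerre_eq_zero` — the Laguerre form.

## References
* [Szego1975] G. Szegő, *Orthogonal Polynomials*, 4th ed. (1975), Theorem 5.7.1 (closure/completeness of the
  Laguerre polynomials), §5.7.
* [AriasDeReyna2011KeiperLi] J. Arias de Reyna, Funct. Approx. Comment. Math. 45 (2011) 7–21, proof of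
  Cor 5.1 p.17.
-/

noncomputable section

open Real Set MeasureTheory Polynomial Filter Topology
open scoped Nat

namespace Literature.Analysis.SpecialFunctions

namespace LaguerreExpansionUniqueness

open Literature.NumberTheory.LFunctions (Landau.mellinIoi Landau.mellinIoiLog)
open Literature.NumberTheory.LFunctions

/-! ### Power moments on `(0,1)` -/

/-- **Moments determine an integrable function on `(0,1)`**: if `V ∈ L¹(0,1)` and `∫₀¹ V(y) yⁿ dy = 0` for
all `n`, then `V = 0` a.e. on `(0,1)` (Weierstrass approximation of smooth test functions by polynomials,
then the smooth-test-function criterion). [cite: Szego1975, Theorem 5.7.1 (proof, §5.7)] -/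
theorem ae_eq_zero_of_forall_integral_pow_eq_zero {V : ℝ → ℝ} (hV : IntegrableOn V (Ioo 0 1))
    (hmom : ∀ n : ℕ, ∫ y in Ioo (0 : ℝ) 1, V y * y ^ n = 0) :
    ∀ᵐ y : ℝ, y ∈ Ioo (0 : ℝ) 1 → V y = 0 := by
  -- integrals against polynomials vanish
  have hpoly : ∀ p : ℝ[X], ∫ y in Ioo (0 : ℝ) 1, p.eval y * V y = 0 := by
    intro p
    have e : (fun y ↦ p.eval y * V y) = fun y ↦
        ∑ i ∈ Finset.range (p.natDegree + 1), p.coeff i * (V y * y ^ i) := by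
      funext y
      rw [Polynomial.eval_eq_sum_range, Finset.sum_mul]
      exact Finset.sum_congr rfl fun i _ ↦ by ring
    have hint : ∀ i : ℕ, IntegrableOn (fun y ↦ V y * y ^ i) (Ioo 0 1) := by
      intro i
      refine Integrable.mono' hV.norm (hV.aestronglyMeasurable.mul (by fun_prop)) ?_
      rw [ae_restrict_iff' measurableSet_Ioo]
      refine Eventually.of_forall fun y hy ↦ ?_
      rw [Real.norm_eq_abs, abs_mul, Real.norm_eq_abs]
      refine mul_le_of_le_one_right (abs_nonneg _) ?_
      rw [abs_pow, abs_of_pos hy.1]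
      exact pow_le_one₀ hy.1.le hy.2.le
    rw [e, integral_finsetSum _ fun i _ ↦ (hint i).const_mul _]
    refine Finset.sum_eq_zero fun i _ ↦ ?_
    rw [integral_const_mul, hmom i, mul_zero]
  -- integrals against functions continuous on `[0,1]` vanish
  have hcont : ∀ g : ℝ → ℝ, ContinuousOn g (Icc 0 1) → ∫ y in Ioo (0 : ℝ) 1, g y * V y = 0 := by
    intro g hg
    -- `|∫ gV| ≤ ε ∫|V|` for every `ε > 0`
    set M : ℝ := ∫ y in Ioo (0 : ℝ) 1, |V y| with hM
    have hM0 : 0 ≤ M := integral_nonneg fun y ↦ abs_nonneg _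
    have hgV : IntegrableOn (fun y ↦ g y * V y) (Ioo 0 1) := by
      have hgc : ContinuousOn g (Icc 0 1) := hg
      have h1 : IntegrableOn (fun y ↦ g y * V y) (Icc 0 1) := by
        have hV' : IntegrableOn V (Icc 0 1) := by
          rw [integrableOn_Icc_iff_integrableOn_Ioc, integrableOn_Ioc_iff_integrableOn_Ioo]; exact hV
        exact hV'.continuousOn_mul hgc isCompact_Icc
      exact h1.mono_set Ioo_subset_Icc_self
    have key : ∀ ε : ℝ, 0 < ε → |∫ y in Ioo (0 : ℝ) 1, g y * V y| ≤ ε * M := by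
      intro ε hε
      obtain ⟨p, hp⟩ := exists_polynomial_near_of_continuousOn 0 1 g hg ε hε
      have hpV : IntegrableOn (fun y ↦ p.eval y * V y) (Ioo 0 1) := by
        have hV' : IntegrableOn V (Icc 0 1) := by
          rw [integrableOn_Icc_iff_integrableOn_Ioc, integrableOn_Ioc_iff_integrableOn_Ioo]; exact hV
        exact (hV'.continuousOn_mul p.continuous.continuousOn isCompact_Icc).mono_set Ioo_subset_Icc_self
      have hsub : (∫ y in Ioo (0 : ℝ) 1, g y * V y) =
          (∫ y in Ioo (0 : ℝ) 1, (g y - p.eval y) * V y) := by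
        rw [show (fun y ↦ (g y - p.eval y) * V y) = fun y ↦ g y * V y - p.eval y * V y by
          funext y; ring, integral_sub hgV hpV, hpoly p, sub_zero]
      rw [hsub]
      calc |∫ y in Ioo (0 : ℝ) 1, (g y - p.eval y) * V y|
          ≤ ∫ y in Ioo (0 : ℝ) 1, |(g y - p.eval y) * V y| := by
            rw [← Real.norm_eq_abs]
            exact (norm_integral_le_integral_norm _).trans (le_of_eq (by simp [Real.norm_eq_abs]))
        _ ≤ ∫ y in Ioo (0 : ℝ) 1, ε * |V y| := by
            have hi1 : IntegrableOn (fun y ↦ |(g y - p.eval y) * V y|) (Ioo 0 1) :=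
              ((hgV.sub hpV).congr_fun (fun y _ ↦ by simp only [Pi.sub_apply]; ring)
                measurableSet_Ioo).abs
            have hi2 : IntegrableOn (fun y ↦ ε * |V y|) (Ioo 0 1) := hV.abs.const_mul ε
            refine setIntegral_mono_on hi1 hi2 measurableSet_Ioo fun y hy ↦ ?_
            rw [abs_mul]
            refine mul_le_mul_of_nonneg_right ?_ (abs_nonneg _)
            rw [abs_sub_comm]
            exact (hp y (Ioo_subset_Icc_self hy)).le
        _ = ε * M := by rw [integral_const_mul]
    -- hence the integral is `0`
    by_contra hne
    have hpos : 0 < |∫ y in Ioo (0 : ℝ) 1, g y * V y| := abs_pos.mpr hne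
    rcases eq_or_lt_of_le hM0 with hM | hM
    · have := key 1 one_pos
      rw [← hM, mul_zero] at this
      linarith
    · have := key (|∫ y in Ioo (0 : ℝ) 1, g y * V y| / (2 * M)) (by positivity)
      have e : |∫ y in Ioo (0 : ℝ) 1, g y * V y| / (2 * M) * M =
          |∫ y in Ioo (0 : ℝ) 1, g y * V y| / 2 := by field_simp
      rw [e] at this
      linarith
  -- the smooth-test-function criterion on the open set `(0,1)`
  have h := IsOpen.ae_eq_zero_of_integral_contDiff_smul_eq_zero (μ := volume) (f := V) isOpen_Ioo
    (hV.locallyIntegrableOn) ?_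
  · exact h
  intro g hg hgs hsupp
  -- `∫ g V` over `ℝ` equals the integral over `(0,1)` since `g` vanishes off `(0,1)`
  have hzero : ∀ y, y ∉ Ioo (0 : ℝ) 1 → g y * V y = 0 := by
    intro y hy
    have : g y = 0 := image_eq_zero_of_notMem_tsupport fun h ↦ hy (hsupp h)
    rw [this, zero_mul]
  have e : ∫ y, g y • V y = ∫ y in Ioo (0 : ℝ) 1, g y * V y := by
    rw [← integral_indicator measurableSet_Ioo]
    refine integral_congr_ae (Eventually.of_forall fun y ↦ ?_)
    show g y • V y = (Ioo 0 1).indicator (fun y => g y * V y) y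
    rw [smul_eq_mul]
    by_cases hy : y ∈ Ioo (0 : ℝ) 1
    · rw [indicator_of_mem hy]
    · rw [indicator_of_notMem hy]; exact hzero y hy
  rw [e]
  exact hcont g hg.continuous.continuousOn

/-! ### From `(1, ∞)` with kernels `x^{−n−1}` to `(0,1)`: `y = 1/x` -/

/-- Change of variables `y = 1/x` from `(0,1)` onto `(1,∞)`: `∫₁^∞ H(x) dx = ∫₀¹ H(1/y) y⁻² dy`. [folklore] -/
private theorem setIntegral_Ioi_one_eq_integral_inv (H : ℝ → ℝ) :
    ∫ x in Ioi (1 : ℝ), H x = ∫ y in Ioo (0 : ℝ) 1, y⁻¹ ^ 2 * H y⁻¹ := by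
  have himg : (fun y : ℝ ↦ y⁻¹) '' Ioo (0 : ℝ) 1 = Ioi 1 := by
    rw [show (fun y : ℝ ↦ y⁻¹) = Inv.inv from rfl, Set.image_inv_eq_inv, Set.inv_Ioo_0_left one_pos,
      inv_one]
  rw [← himg, integral_image_eq_integral_abs_deriv_smul measurableSet_Ioo
    (f := fun y : ℝ ↦ y⁻¹) (f' := fun y : ℝ ↦ -(y ^ 2)⁻¹)
    (fun y hy ↦ (hasDerivAt_inv hy.1.ne').hasDerivWithinAt) inv_injective.injOn]
  refine setIntegral_congr_fun measurableSet_Ioo fun y hy ↦ ?_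
  rw [abs_neg, abs_inv, abs_of_pos (pow_pos hy.1 2), smul_eq_mul, inv_pow]

/-- Integrability transfer for `y = 1/x`. [folklore] -/
private theorem integrableOn_Ioi_one_iff_integrableOn_inv (H : ℝ → ℝ) :
    IntegrableOn H (Ioi 1) ↔ IntegrableOn (fun y ↦ y⁻¹ ^ 2 * H y⁻¹) (Ioo 0 1) := by
  have himg : (fun y : ℝ ↦ y⁻¹) '' Ioo (0 : ℝ) 1 = Ioi 1 := by
    rw [show (fun y : ℝ ↦ y⁻¹) = Inv.inv from rfl, Set.image_inv_eq_inv, Set.inv_Ioo_0_left one_pos,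
      inv_one]
  rw [← himg, integrableOn_image_iff_integrableOn_abs_deriv_smul measurableSet_Ioo
    (f := fun y : ℝ ↦ y⁻¹) (f' := fun y : ℝ ↦ -(y ^ 2)⁻¹)
    (fun y hy ↦ (hasDerivAt_inv hy.1.ne').hasDerivWithinAt) inv_injective.injOn]
  refine integrableOn_congr_fun (fun y hy ↦ ?_) measurableSet_Ioo
  rw [abs_neg, abs_inv, abs_of_pos (pow_pos hy.1 2), smul_eq_mul, inv_pow]

/-- If `G ∈ L¹((1,∞), x⁻² dx)` and `∫₁^∞ G(x) x^{−(n+1)} dx = 0` for all `n ≥ 1`, then `G = 0` a.e. on `(1,∞)`.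
[cite: Szego1975, Theorem 5.7.1 (proof, §5.7)] -/
theorem ae_eq_zero_of_forall_integral_mul_zpow_eq_zero {G : ℝ → ℝ}
    (hG : IntegrableOn (fun x ↦ G x * x ^ (-(2 : ℝ))) (Ioi 1))
    (hmom : ∀ n : ℕ, 1 ≤ n → ∫ x in Ioi (1 : ℝ), G x * x ^ (-((n : ℝ) + 1)) = 0) :
    ∀ᵐ x : ℝ, x ∈ Ioi (1 : ℝ) → G x = 0 := by
  -- `V(y) = G(1/y)` on `(0,1)`
  set V : ℝ → ℝ := fun y ↦ G y⁻¹ with hV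
  have hrw : ∀ {y : ℝ}, y ∈ Ioo (0 : ℝ) 1 → ∀ r : ℝ, y⁻¹ ^ 2 * (G y⁻¹ * y⁻¹ ^ r) = V y * y ^ (-r - 2) := by
    intro y hy r
    have hy0 : 0 < y := hy.1
    simp only [hV]
    rw [Real.inv_rpow hy0.le, ← Real.rpow_neg hy0.le, show y⁻¹ ^ 2 = y ^ (-(2 : ℝ)) by
      rw [Real.rpow_neg hy0.le, show (2 : ℝ) = (2 : ℕ) by norm_num, Real.rpow_natCast, inv_pow],
      mul_comm, mul_assoc, ← Real.rpow_add hy0]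
    ring_nf
  have hVint : IntegrableOn V (Ioo 0 1) := by
    have h := (integrableOn_Ioi_one_iff_integrableOn_inv _).mp hG
    refine (h.congr_fun (fun y hy ↦ ?_) measurableSet_Ioo)
    beta_reduce
    rw [hrw hy]
    norm_num
  have hVmom : ∀ n : ℕ, ∫ y in Ioo (0 : ℝ) 1, V y * y ^ n = 0 := by
    intro n
    have h := hmom (n + 1) (by omega)
    rw [setIntegral_Ioi_one_eq_integral_inv] at h
    refine Eq.trans (setIntegral_congr_fun measurableSet_Ioo fun y hy ↦ ?_) h
    rw [hrw hy, ← Real.rpow_natCast y n]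
    congr 2
    push_cast
    ring
  have hVae := ae_eq_zero_of_forall_integral_pow_eq_zero hVint hVmom
  -- `∫₁^∞ |G| x⁻² = ∫₀¹ |V| = 0`
  have habs : ∫ x in Ioi (1 : ℝ), |G x| * x ^ (-(2 : ℝ)) = 0 := by
    rw [setIntegral_Ioi_one_eq_integral_inv]
    have e : ∀ y ∈ Ioo (0 : ℝ) 1, y⁻¹ ^ 2 * (|G y⁻¹| * y⁻¹ ^ (-(2 : ℝ))) = |V y| := by
      intro y hy
      have hy0 : 0 < y := hy.1
      simp only [hV]
      rw [Real.inv_rpow hy0.le, Real.rpow_neg hy0.le, inv_inv,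
        show y ^ (2 : ℝ) = y ^ 2 by rw [show (2 : ℝ) = (2 : ℕ) by norm_num, Real.rpow_natCast]]
      field_simp
    rw [setIntegral_congr_fun measurableSet_Ioo e]
    refine integral_eq_zero_of_ae ?_
    rw [EventuallyEq, ae_restrict_iff' measurableSet_Ioo]
    filter_upwards [hVae] with y hy hy'
    simp [hy hy']
  -- a nonnegative integrable function with zero integral vanishes a.e.
  have hnn : 0 ≤ᵐ[volume.restrict (Ioi (1 : ℝ))] fun x ↦ |G x| * x ^ (-(2 : ℝ)) := by
    rw [EventuallyLE, ae_restrict_iff' measurableSet_Ioi]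
    exact Eventually.of_forall fun x (hx : 1 < x) ↦ by positivity
  have hint : IntegrableOn (fun x ↦ |G x| * x ^ (-(2 : ℝ))) (Ioi 1) := by
    refine IntegrableOn.congr_fun hG.norm (fun x (hx : 1 < x) ↦ ?_) measurableSet_Ioi
    rw [norm_mul, Real.norm_eq_abs, Real.norm_eq_abs,
      abs_of_pos (Real.rpow_pos_of_pos (by linarith) _)]
  have hz := (integral_eq_zero_iff_of_nonneg_ae hnn hint).mp habs
  rw [EventuallyEq, ae_restrict_iff' measurableSet_Ioi] at hz
  filter_upwards [hz] with x hx hx1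
  have h := hx hx1
  simp only [Pi.zero_apply, mul_eq_zero, abs_eq_zero] at h
  rcases h with h | h
  · exact h
  · exfalso; exact (Real.rpow_pos_of_pos (by linarith [show (1:ℝ) < x from hx1]) _).ne' h

/-! ### Log-moments on `(1,∞)` via the Mellin transform -/

/-- If `∫₁^∞ |G(x)| x^{δ−1} dx < ∞` for some `δ > 0` and all log-moments `∫₁^∞ G(x)(log x)ᵏ x⁻¹ dx` vanish,
then `G = 0` a.e. on `(1,∞)`: the transform `Φ(s) = ∫₁^∞ G x^{−s−1}` is holomorphic on `Re s > −δ` with all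
derivatives `0` at `s = 0`, hence `Φ ≡ 0`, and the previous lemma applies.
[cite: Szego1975, Theorem 5.7.1 (proof, §5.7)] -/
theorem ae_eq_zero_of_forall_integral_mul_log_pow_eq_zero {G : ℝ → ℝ} (hGm : Measurable G) {δ : ℝ}
    (hδ : 0 < δ) (hG : IntegrableOn (fun x ↦ G x * x ^ (-(-δ + 1))) (Ioi 1))
    (hmom : ∀ k : ℕ, ∫ x in Ioi (1 : ℝ), G x * Real.log x ^ k * x ^ (-((0 : ℝ) + 1)) = 0) :
    ∀ᵐ x : ℝ, x ∈ Ioi (1 : ℝ) → G x = 0 := by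
  set Φ : ℂ → ℂ := Landau.mellinIoi G with hΦ
  have hU : IsOpen {s : ℂ | -δ < s.re} := Landau.isOpen_re_gt (-δ)
  have hdiff : DifferentiableOn ℂ Φ {s : ℂ | -δ < s.re} := Landau.differentiableOn_mellinIoi hGm hG
  have han : AnalyticOnNhd ℂ Φ {s : ℂ | -δ < s.re} := hdiff.analyticOnNhd hU
  have h0 : (0 : ℂ) ∈ {s : ℂ | -δ < s.re} := by simp [hδ]
  -- all derivatives vanish at `0`
  have hder : ∀ k, iteratedDeriv k Φ 0 = 0 := by
    intro k
    rw [hΦ, Landau.iteratedDeriv_mellinIoi hGm hG k (by simp [hδ]),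
      show (0 : ℂ) = ((0 : ℝ) : ℂ) by simp, Landau.mellinIoiLog_ofReal, hmom k]
    simp
  -- hence `Φ = 0` near `0` (Taylor series) and on the half-plane (identity theorem)
  have hloc : Φ =ᶠ[𝓝 0] 0 := by
    obtain ⟨r, hr0, hr⟩ := Metric.isOpen_iff.1 hU 0 h0
    have hd : DifferentiableOn ℂ Φ (Metric.ball 0 r) := hdiff.mono hr
    filter_upwards [Metric.ball_mem_nhds (0 : ℂ) hr0] with z hz
    have hT := Complex.hasSum_taylorSeries_on_ball hd hz
    have hT0 : HasSum (fun n : ℕ ↦ (0 : ℂ)) (Φ z) := by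
      refine hT.congr_fun fun n ↦ ?_
      rw [hder n, smul_zero, smul_zero]
    simpa using hT0.tsum_eq.symm.trans tsum_zero
  have hzero : EqOn Φ 0 {s : ℂ | -δ < s.re} :=
    han.eqOn_zero_of_preconnected_of_eventuallyEq_zero (convex_halfSpace_re_gt (-δ)).isPreconnected h0 hloc
  -- moments with kernels `x^{−(n+1)}`
  have hG2 : IntegrableOn (fun x ↦ G x * x ^ (-(2 : ℝ))) (Ioi 1) := by
    have := Landau.integrableOn_rpow_of_le hGm (σ₁ := -δ) (σ := 1) (by linarith) hG
    refine this.congr_fun (fun x _ ↦ by norm_num) measurableSet_Ioi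
  refine ae_eq_zero_of_forall_integral_mul_zpow_eq_zero hG2 fun n hn ↦ ?_
  have h := hzero (show ((n : ℝ) : ℂ) ∈ {s : ℂ | -δ < s.re} by simp; linarith [n.cast_nonneg (α := ℝ)])
  rw [hΦ, Pi.zero_apply, ← Landau.mellinIoiLog_zero, Landau.mellinIoiLog_ofReal] at h
  simp only [pow_zero, one_mul, Complex.ofReal_eq_zero] at h
  rw [← h]
  refine setIntegral_congr_fun measurableSet_Ioi fun x _ ↦ ?_
  simp

/-! ### The theorem on `(0, ∞)` -/

/-- **Moments determine an exponentially tempered function on `(0,∞)`**: if `w` is measurable,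
`∫₀^∞ |w(t)| e^{δt} dt < ∞` for some `δ > 0`, and `∫₀^∞ w(t) tᵏ dt = 0` for every `k`, then `w = 0` a.e. on
`(0,∞)` (`x = eᵗ` reduces to the previous lemma). [cite: Szego1975, Theorem 5.7.1] -/
theorem ae_eq_zero_of_forall_integral_mul_pow_eq_zero {w : ℝ → ℝ} (hwm : Measurable w) {δ : ℝ}
    (hδ : 0 < δ) (hw : IntegrableOn (fun t ↦ w t * Real.exp (δ * t)) (Ioi 0))
    (hmom : ∀ k : ℕ, ∫ t in Ioi (0 : ℝ), w t * t ^ k = 0) :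
    ∀ᵐ t : ℝ, t ∈ Ioi (0 : ℝ) → w t = 0 := by
  set G : ℝ → ℝ := fun x ↦ w (Real.log x) with hGdef
  have hGm : Measurable G := hwm.comp Real.measurable_log
  -- weight transfer: `eᵗ · (G(eᵗ) (eᵗ)^{δ−1}) = w(t) e^{δt}`
  have hpt : ∀ t : ℝ, Real.exp t * (G (Real.exp t) * Real.exp t ^ (-(-δ + 1))) =
      w t * Real.exp (δ * t) := by
    intro t
    simp only [hGdef, Real.log_exp]
    rw [← Real.exp_mul]
    have : Real.exp t * Real.exp (t * -(-δ + 1)) = Real.exp (δ * t) := by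
      rw [← Real.exp_add]; ring_nf
    calc Real.exp t * (w t * Real.exp (t * -(-δ + 1))) = w t * (Real.exp t * Real.exp (t * -(-δ + 1))) := by
          ring
      _ = w t * Real.exp (δ * t) := by rw [this]
  have hG : IntegrableOn (fun x ↦ G x * x ^ (-(-δ + 1))) (Ioi 1) := by
    rw [LogIntegralLaplace.integrableOn_Ioi_one_iff_integrableOn_exp]
    simp_rw [hpt]
    exact hw
  have hGmom : ∀ k : ℕ, ∫ x in Ioi (1 : ℝ), G x * Real.log x ^ k * x ^ (-((0 : ℝ) + 1)) = 0 := by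
    intro k
    rw [LogIntegralLaplace.setIntegral_Ioi_one_eq_integral_exp]
    refine Eq.trans (setIntegral_congr_fun measurableSet_Ioi fun t _ ↦ ?_) (hmom k)
    simp only [hGdef, Real.log_exp]
    rw [← Real.exp_mul]
    have : Real.exp t * Real.exp (t * -((0 : ℝ) + 1)) = 1 := by
      rw [← Real.exp_add]; norm_num
    calc Real.exp t * (w t * t ^ k * Real.exp (t * -((0 : ℝ) + 1)))
        = w t * t ^ k * (Real.exp t * Real.exp (t * -((0 : ℝ) + 1))) := by ring
      _ = w t * t ^ k := by rw [this, mul_one]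
  have hGae := ae_eq_zero_of_forall_integral_mul_log_pow_eq_zero hGm hδ hG hGmom
  -- `∫₀^∞ |w| e^{δt} = ∫₁^∞ |G| x^{δ−1} = 0`
  have habs : ∫ t in Ioi (0 : ℝ), |w t| * Real.exp (δ * t) = 0 := by
    have e : (∫ t in Ioi (0 : ℝ), |w t| * Real.exp (δ * t)) =
        ∫ x in Ioi (1 : ℝ), |G x| * x ^ (-(-δ + 1)) := by
      rw [LogIntegralLaplace.setIntegral_Ioi_one_eq_integral_exp]
      refine setIntegral_congr_fun measurableSet_Ioi fun t _ ↦ ?_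
      have h := hpt t
      simp only [hGdef, Real.log_exp] at h ⊢
      rw [show Real.exp t * (|w t| * Real.exp t ^ (-(-δ + 1))) =
        |w t| * (Real.exp t * Real.exp t ^ (-(-δ + 1))) by ring]
      have h2 : Real.exp t * Real.exp t ^ (-(-δ + 1)) = Real.exp (δ * t) := by
        rw [← Real.exp_mul, ← Real.exp_add]; ring_nf
      rw [h2]
    rw [e]
    refine integral_eq_zero_of_ae ?_
    rw [EventuallyEq, ae_restrict_iff' measurableSet_Ioi]
    filter_upwards [hGae] with x hx hx1
    simp [hx hx1]
  have hnn : 0 ≤ᵐ[volume.restrict (Ioi (0 : ℝ))] fun t ↦ |w t| * Real.exp (δ * t) :=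
    Eventually.of_forall fun t ↦ by positivity
  have hint : IntegrableOn (fun t ↦ |w t| * Real.exp (δ * t)) (Ioi 0) := by
    refine IntegrableOn.congr_fun hw.norm (fun t _ ↦ ?_) measurableSet_Ioi
    rw [norm_mul, Real.norm_eq_abs, Real.norm_eq_abs, Real.abs_exp]
  have hz := (integral_eq_zero_iff_of_nonneg_ae hnn hint).mp habs
  rw [EventuallyEq, ae_restrict_iff' measurableSet_Ioi] at hz
  filter_upwards [hz] with t ht ht0
  have h := ht ht0
  simp only [Pi.zero_apply, mul_eq_zero, abs_eq_zero] at h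
  rcases h with h | h
  · exact h
  · exact absurd h (Real.exp_pos _).ne'

/-- Integrability of the moments `w tᵏ` from the weight `e^{δt}` (`(δt)ᵏ/k! ≤ e^{δt}`).
[cite: Szego1975, Theorem 5.7.1 (proof, §5.7)] -/
theorem integrableOn_mul_pow_of_exp {w : ℝ → ℝ} (hwm : Measurable w) {δ : ℝ} (hδ : 0 < δ)
    (hw : IntegrableOn (fun t ↦ w t * Real.exp (δ * t)) (Ioi 0)) (k : ℕ) :
    IntegrableOn (fun t ↦ w t * t ^ k) (Ioi 0) := by
  -- `tᵏ ≤ (k/δ)^k e^{δt}`-type bound: `(δt)^k/k! ≤ e^{δt}`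
  have hb : ∀ t : ℝ, 0 < t → t ^ k ≤ (k ! : ℝ) / δ ^ k * Real.exp (δ * t) := by
    intro t ht
    have h := Real.pow_div_factorial_le_exp (δ * t) (by positivity) k
    rw [mul_pow] at h
    have hδk : 0 < δ ^ k := pow_pos hδ k
    have hk : (0 : ℝ) < k ! := by positivity
    rw [div_le_iff₀ hk] at h
    rw [div_mul_eq_mul_div, le_div_iff₀ hδk]
    linarith
  refine Integrable.mono' ((hw.norm.const_mul ((k ! : ℝ) / δ ^ k))) (hwm.mul (by fun_prop)).aestronglyMeasurable ?_
  rw [ae_restrict_iff' measurableSet_Ioi]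
  refine Eventually.of_forall fun t (ht : 0 < t) ↦ ?_
  rw [Real.norm_eq_abs, abs_mul, norm_mul, Real.norm_eq_abs, Real.norm_eq_abs, Real.abs_exp,
    abs_of_pos (pow_pos ht k)]
  calc |w t| * t ^ k ≤ |w t| * ((k ! : ℝ) / δ ^ k * Real.exp (δ * t)) :=
        mul_le_mul_of_nonneg_left (hb t ht) (abs_nonneg _)
    _ = (k ! : ℝ) / δ ^ k * (|w t| * Real.exp (δ * t)) := by ring

/-- **Uniqueness of Laguerre expansions** (Szegő Thm 5.7.1, uniqueness form): if `w` is measurable with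
`∫₀^∞ |w(t)| e^{δt} dt < ∞` for some `δ > 0` and `∫₀^∞ w(t) L_n(t) dt = 0` for every Laguerre polynomial
`L_n`, then `w = 0` a.e. on `(0,∞)` (the `L_n`, `deg L_n = n`, span all polynomials).
[cite: Szego1975, Theorem 5.7.1] -/
theorem ae_eq_zero_of_forall_integral_mul_laguerre_eq_zero {w : ℝ → ℝ} (hwm : Measurable w) {δ : ℝ}
    (hδ : 0 < δ) (hw : IntegrableOn (fun t ↦ w t * Real.exp (δ * t)) (Ioi 0))
    (hlag : ∀ n : ℕ, ∫ t in Ioi (0 : ℝ), w t * (laguerre 0 n).eval t = 0) :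
    ∀ᵐ t : ℝ, t ∈ Ioi (0 : ℝ) → w t = 0 := by
  have hint := integrableOn_mul_pow_of_exp hwm hδ hw
  -- moments vanish, by strong induction on `k`
  have hmom : ∀ k : ℕ, ∫ t in Ioi (0 : ℝ), w t * t ^ k = 0 := by
    intro k
    induction k using Nat.strong_induction_on with
    | _ k ih =>
      -- `∫ w L_k = Σ_{j ≤ k} c_{kj} ∫ w t^j = c_{kk} ∫ w t^k` (lower moments vanish), and `c_{kk} ≠ 0`
      have h := hlag k
      have e : (fun t ↦ w t * (laguerre 0 k).eval t) = fun t ↦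
          ∑ j ∈ Finset.range (k + 1), laguerreCoeff 0 k j * (w t * t ^ j) := by
        funext t
        rw [eval_laguerre, Finset.mul_sum]
        exact Finset.sum_congr rfl fun j _ ↦ by ring
      rw [e, integral_finsetSum _ fun j _ ↦ (hint j).const_mul _, Finset.sum_range_succ] at h
      have hlow : ∑ j ∈ Finset.range k, (∫ t in Ioi (0 : ℝ), laguerreCoeff 0 k j * (w t * t ^ j)) = 0 := by
        refine Finset.sum_eq_zero fun j hj ↦ ?_
        rw [integral_const_mul, ih j (Finset.mem_range.mp hj), mul_zero]
      rw [hlow, zero_add, integral_const_mul] at h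
      have hc : laguerreCoeff 0 k k ≠ 0 := by
        rw [laguerreCoeff_self]
        have : (k ! : ℝ) ≠ 0 := by positivity
        exact div_ne_zero (pow_ne_zero _ (by norm_num)) this
      exact (mul_eq_zero.mp h).resolve_left hc
  exact ae_eq_zero_of_forall_integral_mul_pow_eq_zero hwm hδ hw hmom

end LaguerreExpansionUniqueness

end Literature.Analysis.SpecialFunctions
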